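import Literature.Combinatorics.AssociationSchemes.JohnsonHarmonics
import HarnessLib

/-!
# Cell pnp-psdrank, route `ChebyshevTracialDesign`: Johnson harmonics against a perfect matching —
# the pairing recurrence, vanishing of odd degrees, and the closed form in even degree

Harmonic backbone, brick 3 (MEMO-7 §1 (1d), the matching-side heart of the saturation factorisation). A perfect
matching of the vertex set is encoded by its partner map, a fixed-point-free involution `π` (for the tree's
`PMatch n` this is `IsPMOn.partner`). For a set `T` let `d_π(T) = #{x ∈ T : π x ∈ T}` (twice the number of matching
edges inside `T`) and, for a Johnson-harmonic coefficient vector `p` of degree `k`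
(`Literature.Combinatorics.AssociationSchemes.JohnsonHarmonics.IsHarmonic`), let `Q_d = Σ_{d_π(T) = d} p_T`.
Summing the harmonicity relation `Σ_{z ∉ T'} p_{T' ∪ z} = 0` over the `T'` with `d_π(T') = d` and re-indexing by
`T = T' ∪ z` (removing `z ∈ T` lowers `d_π` by `2·[π z ∈ T]`) gives the PAIRING RECURRENCE
`(d+2)·Q_{d+2} + (k−d)·Q_d = 0` (`pairing_recurrence`). Consequences: for ODD `k` every `Q_d` vanishes
(`pairedSum_eq_zero_of_odd`: the top class `d_π(T) = |T|` is empty for odd `|T|` since `π` pairs `T` up, then descend),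
and for `k = 2κ`, `Q_{2s} = (−1)^{κ−s} C(κ,s) · Q_{2κ}` (`pairedSum_eq_of_even`), where `Q_{2κ} = Σ_{T = π T, |T| = k} p_T`
is the sum over the sets made of `κ` matching edges (MEMO-7's `Π_p(M)`). These identities say that every level kernel of
Rothvoß's slack matrix kills the odd Johnson layers and is rank one in the level on the even ones
[cite: Rothvoss2017, §2 (PDF p. 6)]; representation-theoretically they reflect that `L²` of the perfect matchings is the
multiplicity-free sum of the even-partition Specht modules [cite: GodsilMeagher2015, §15.2 (perfect matching scheme)],
but the proof here is a double count. WHAT THIS IS NOT: no eigenvalue yet (the `B`-scalar `C(n/2 − k, a − k/2)` and the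
tight spectrum are the next bricks); nothing on psd rank. Supports crux stmt-PneNP-19878.
-/

set_option linter.dupNamespace false -- `Summit.PneNP.PneNP.…`: summit = sub-problem (D-0017)

noncomputable section

namespace Summit.PneNP.PneNP.Theorems.ChebyshevTracialDesignMatchingHarmonics

open Finset Literature.Combinatorics.AssociationSchemes Literature.Combinatorics.AssociationSchemes.JohnsonHarmonics

variable {n : ℕ}

/-! ### §1 Removing a point changes the number of internally paired points by `0` or `2` -/

/-- For a fixed-point-free involution `π` and `z ∈ T`: the internally paired points of `T \ {z}` are those of `T`
minus `z` and `π z`; so `d_π(T \ z) = d_π(T) − 2` if `π z ∈ T` and `= d_π(T)` otherwise. -/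
theorem card_paired_erase {π : Fin n → Fin n} (hinv : ∀ x, π (π x) = x) (hfix : ∀ x, π x ≠ x)
    {T : Finset (Fin n)} {z : Fin n} (hz : z ∈ T) :
    ((T.erase z).filter (fun x => π x ∈ T.erase z)).card =
      (T.filter (fun x => π x ∈ T)).card - (if π z ∈ T then 2 else 0) := by
  classical
  by_cases hπz : π z ∈ T
  · rw [if_pos hπz]
    have hsub : ({z, π z} : Finset (Fin n)) ⊆ T.filter (fun x => π x ∈ T) := by
      intro x hx
      rcases mem_insert.1 hx with rfl | hx
      · exact mem_filter.2 ⟨hz, hπz⟩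
      · rw [mem_singleton.1 hx]; exact mem_filter.2 ⟨hπz, by rw [hinv]; exact hz⟩
    have heq : (T.erase z).filter (fun x => π x ∈ T.erase z) = T.filter (fun x => π x ∈ T) \ {z, π z} := by
      ext x
      simp only [mem_filter, mem_erase, mem_sdiff, mem_insert, mem_singleton, not_or]
      constructor
      · rintro ⟨⟨hxz, hxT⟩, hπxz, hπxT⟩
        refine ⟨⟨hxT, hπxT⟩, hxz, fun h => hπxz ?_⟩
        rw [h, hinv]
      · rintro ⟨⟨hxT, hπxT⟩, hxz, hxπz⟩
        refine ⟨⟨hxz, hxT⟩, fun h => hxπz ?_, hπxT⟩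
        rw [← h, hinv]
    rw [heq, card_sdiff_of_subset hsub, card_pair (hfix z).symm]
  · rw [if_neg hπz, Nat.sub_zero]
    congr 1
    ext x
    simp only [mem_filter, mem_erase]
    constructor
    · rintro ⟨⟨-, hxT⟩, -, hπxT⟩; exact ⟨hxT, hπxT⟩
    · rintro ⟨hxT, hπxT⟩
      refine ⟨⟨fun h => hπz (h ▸ hπxT), hxT⟩, fun h => ?_, hπxT⟩
      exact hπz (by rw [← h, hinv]; exact hxT)

/-- `d_π(T) ≤ |T|`, and the unpaired points number `|T| − d_π(T)`. -/
theorem card_paired_add_card_unpaired (π : Fin n → Fin n) (T : Finset (Fin n)) :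
    (T.filter (fun x => π x ∈ T)).card + (T.filter (fun x => π x ∉ T)).card = T.card :=
  card_filter_add_card_filter_not _

/-- The number of `z ∈ T` with `d_π(T \ z) = d` is `(d+2)·[d_π(T) = d+2] + (|T| − d)·[d_π(T) = d]`. -/
theorem card_filter_paired_erase_eq {π : Fin n → Fin n} (hinv : ∀ x, π (π x) = x) (hfix : ∀ x, π x ≠ x)
    (T : Finset (Fin n)) (d : ℕ) :
    ((T.filter fun z => ((T.erase z).filter (fun x => π x ∈ T.erase z)).card = d).card : ℝ) =
      (if (T.filter (fun x => π x ∈ T)).card = d + 2 then ((d : ℝ) + 2) else 0) +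
        (if (T.filter (fun x => π x ∈ T)).card = d then ((T.card : ℝ) - d) else 0) := by
  classical
  set D := (T.filter (fun x => π x ∈ T)).card with hD
  -- rewrite the predicate using `card_paired_erase`
  have hpred : T.filter (fun z => ((T.erase z).filter (fun x => π x ∈ T.erase z)).card = d) =
      T.filter (fun z => D - (if π z ∈ T then 2 else 0) = d) := by
    refine filter_congr fun z hz => ?_
    rw [card_paired_erase hinv hfix hz]
  rw [hpred]
  -- split `T` into paired and unpaired points
  have hsplit : T.filter (fun z => D - (if π z ∈ T then 2 else 0) = d) =
      (T.filter (fun x => π x ∈ T)).filter (fun _ => D - 2 = d) ∪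
        (T.filter (fun x => π x ∉ T)).filter (fun _ => D = d) := by
    ext z
    simp only [mem_filter, mem_union]
    constructor
    · rintro ⟨hzT, h⟩
      by_cases hπ : π z ∈ T
      · rw [if_pos hπ] at h; exact Or.inl ⟨⟨hzT, hπ⟩, h⟩
      · rw [if_neg hπ, Nat.sub_zero] at h; exact Or.inr ⟨⟨hzT, hπ⟩, h⟩
    · rintro (⟨⟨hzT, hπ⟩, h⟩ | ⟨⟨hzT, hπ⟩, h⟩)
      · exact ⟨hzT, by rw [if_pos hπ]; exact h⟩
      · exact ⟨hzT, by rw [if_neg hπ, Nat.sub_zero]; exact h⟩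
  have hdisj : Disjoint ((T.filter (fun x => π x ∈ T)).filter (fun _ => D - 2 = d))
      ((T.filter (fun x => π x ∉ T)).filter (fun _ => D = d)) :=
    disjoint_filter_filter (disjoint_filter_filter_not T T (fun x => π x ∈ T))
  rw [hsplit, card_union_of_disjoint hdisj, filter_const, filter_const, Nat.cast_add]
  have hunp : ((T.filter (fun x => π x ∉ T)).card : ℝ) = (T.card : ℝ) - D := by
    have := card_paired_add_card_unpaired π T
    rw [← hD] at this
    rw [← this]; push_cast; ring
  -- `D - 2 = d` with `D ≥ 2` available iff `D = d + 2`; the degenerate case `D < 2, d = 0` has no paired points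
  congr 1
  · by_cases h : D - 2 = d
    · rw [if_pos h]
      by_cases h2 : D = d + 2
      · rw [if_pos h2, ← hD, h2]; push_cast; ring
      · -- then `D ≤ 1` and `d = 0`; but `D ≤ 1` forces `D = 0` (paired points come in pairs) — we only need the count
        have hD0 : D ≤ 1 := by omega
        -- the paired-point set has at most one element, yet is closed under `π` without fixed points: it is empty
        have hempty : T.filter (fun x => π x ∈ T) = ∅ := by
          by_contra hne
          obtain ⟨x, hx⟩ := nonempty_iff_ne_empty.2 hne
          have hπx : π x ∈ T.filter (fun x => π x ∈ T) := by
            rw [mem_filter] at hx ⊢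
            exact ⟨hx.2, by rw [hinv]; exact hx.1⟩
          have h1 : (T.filter (fun x => π x ∈ T)).card ≤ 1 := hD ▸ hD0
          have := card_le_one.1 h1 _ hπx _ hx
          exact hfix x this
        rw [if_neg h2, hempty]; simp
    · rw [if_neg h]
      have h2 : ¬ D = d + 2 := fun h2 => h (by omega)
      rw [if_neg h2]; simp
  · by_cases h : D = d
    · rw [if_pos h, if_pos h, hunp, h]
    · rw [if_neg h, if_neg h]; simp

/-! ### §2 The pairing recurrence -/

/-- **Pairing recurrence.** For a fixed-point-free involution `π`, a harmonic `p` of degree `k` and every `d`: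
`(d+2)·Σ_{d_π(T) = d+2} p_T + (k−d)·Σ_{d_π(T) = d} p_T = 0`. -/
theorem pairing_recurrence {π : Fin n → Fin n} (hinv : ∀ x, π (π x) = x) (hfix : ∀ x, π x ≠ x)
    {k : ℕ} {p : Finset (Fin n) → ℝ} (hp : IsHarmonic k p) (d : ℕ) :
    ((d : ℝ) + 2) * ∑ T ∈ univ.filter (fun T : Finset (Fin n) => (T.filter (fun x => π x ∈ T)).card = d + 2), p T +
      ((k : ℝ) - d) * ∑ T ∈ univ.filter (fun T : Finset (Fin n) => (T.filter (fun x => π x ∈ T)).card = d), p T = 0 := by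
  classical
  set c : Finset (Fin n) → ℝ := fun T' => if (T'.filter (fun x => π x ∈ T')).card = d then 1 else 0 with hc
  have h0 : ∑ T' : Finset (Fin n), c T' * down p T' = 0 := by rw [hp.2]; simp
  -- swap the sums as in the zonal recurrence
  have hswap : ∑ T' : Finset (Fin n), c T' * down p T' =
      ∑ T : Finset (Fin n), p T * ∑ x ∈ T, c (T.erase x) := by
    simp only [down_apply, mul_sum]
    have hL : ∑ T' : Finset (Fin n), ∑ x ∈ T'ᶜ, c T' * p (insert x T') =
        ∑ x : Fin n, ∑ T' ∈ univ.filter (fun T' : Finset (Fin n) => x ∉ T'), c T' * p (insert x T') := by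
      rw [sum_comm' (t' := univ) (s' := fun x => univ.filter (fun T' : Finset (Fin n) => x ∉ T'))]
      intro x T'; simp
    have hR : ∑ T : Finset (Fin n), ∑ x ∈ T, p T * c (T.erase x) =
        ∑ x : Fin n, ∑ T ∈ univ.filter (fun T : Finset (Fin n) => x ∈ T), p T * c (T.erase x) := by
      rw [sum_comm' (t' := univ) (s' := fun x => univ.filter (fun T : Finset (Fin n) => x ∈ T))]
      intro x T; simp
    rw [hL, hR]
    refine sum_congr rfl fun x _ => ?_
    rw [sum_filter_mem_eq_sum_filter_not_mem x (fun T => p T * c (T.erase x))]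
    refine sum_congr rfl fun T' hT' => ?_
    simp only [mem_filter, mem_univ, true_and] at hT'
    rw [erase_insert hT', mul_comm]
  have hcount : ∀ T : Finset (Fin n), ∑ x ∈ T, c (T.erase x) =
      (if (T.filter (fun x => π x ∈ T)).card = d + 2 then ((d : ℝ) + 2) else 0) +
        (if (T.filter (fun x => π x ∈ T)).card = d then ((T.card : ℝ) - d) else 0) := by
    intro T
    rw [← card_filter_paired_erase_eq hinv hfix T d, hc]
    simp only
    rw [← sum_filter, sum_const, nsmul_eq_mul, mul_one]
  rw [hswap] at h0
  simp only [hcount] at h0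
  have hdist : ∑ T : Finset (Fin n), p T *
      ((if (T.filter (fun x => π x ∈ T)).card = d + 2 then ((d : ℝ) + 2) else 0) +
        (if (T.filter (fun x => π x ∈ T)).card = d then ((T.card : ℝ) - d) else 0)) =
      ∑ T ∈ univ.filter (fun T : Finset (Fin n) => (T.filter (fun x => π x ∈ T)).card = d + 2), p T * ((d : ℝ) + 2) +
        ∑ T ∈ univ.filter (fun T : Finset (Fin n) => (T.filter (fun x => π x ∈ T)).card = d),
          p T * ((T.card : ℝ) - d) := by
    rw [sum_filter, sum_filter, ← sum_add_distrib]
    refine sum_congr rfl fun T _ => ?_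
    split_ifs <;> ring
  rw [hdist] at h0
  -- on the support, `|T| = k`
  have hsupp : ∑ T ∈ univ.filter (fun T : Finset (Fin n) => (T.filter (fun x => π x ∈ T)).card = d),
        p T * ((T.card : ℝ) - d) =
      ((k : ℝ) - d) * ∑ T ∈ univ.filter (fun T : Finset (Fin n) => (T.filter (fun x => π x ∈ T)).card = d), p T := by
    rw [mul_sum]
    refine sum_congr rfl fun T _ => ?_
    by_cases hTk : T.card = k
    · rw [hTk, mul_comm]
    · rw [hp.1 T hTk]; ring
  have hfirst : ∑ T ∈ univ.filter (fun T : Finset (Fin n) => (T.filter (fun x => π x ∈ T)).card = d + 2),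
        p T * ((d : ℝ) + 2) =
      ((d : ℝ) + 2) * ∑ T ∈ univ.filter (fun T : Finset (Fin n) => (T.filter (fun x => π x ∈ T)).card = d + 2), p T := by
    rw [mul_sum]; exact sum_congr rfl fun T _ => mul_comm _ _
  rw [hsupp, hfirst] at h0
  linarith

/-! ### §3 Consequences: odd degrees vanish; closed form in even degree -/

/-- A set all of whose points are internally paired has even size; so for `|T|` odd, `d_π(T) < |T|`. -/
theorem card_paired_lt_card_of_odd {π : Fin n → Fin n} (hinv : ∀ x, π (π x) = x) (hfix : ∀ x, π x ≠ x)
    {T : Finset (Fin n)} (hT : Odd T.card) : (T.filter (fun x => π x ∈ T)).card < T.card := by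
  classical
  refine lt_of_le_of_ne (card_filter_le _ _) fun heq => ?_
  -- if every point of `T` is paired inside `T`, then `T` is a disjoint union of pairs `{x, π x}`
  have hall : ∀ x ∈ T, π x ∈ T := by
    have := eq_of_subset_of_card_le (filter_subset (fun x => π x ∈ T) T) heq.ge
    intro x hx
    have hx' : x ∈ T.filter (fun x => π x ∈ T) := by rw [this]; exact hx
    exact (mem_filter.1 hx').2
  let f : Fin n → Finset (Fin n) := fun x => {x, π x}
  have hcard := card_eq_sum_card_fiberwise (f := f) (s := T) (t := T.image f) fun x hx => mem_image_of_mem f hx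
  have htwo : ∀ e ∈ T.image f, (T.filter fun x => f x = e).card = 2 := by
    intro e he
    obtain ⟨x, hx, rfl⟩ := mem_image.1 he
    have hset : (T.filter fun y => f y = f x) = {x, π x} := by
      ext y
      simp only [mem_filter, mem_insert, mem_singleton, f]
      constructor
      · rintro ⟨-, h⟩
        have hy : y ∈ ({y, π y} : Finset (Fin n)) := mem_insert_self _ _
        rw [h] at hy
        simpa using hy
      · rintro (rfl | rfl)
        · exact ⟨hx, rfl⟩
        · exact ⟨hall x hx, by rw [hinv, pair_comm]⟩
    rw [hset, card_pair (hfix x).symm]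
  rw [sum_congr rfl htwo, sum_const, smul_eq_mul] at hcard
  exact (Nat.not_even_iff_odd.2 hT) ⟨(T.image f).card, by omega⟩

/-- **Odd degrees vanish.** For a fixed-point-free involution `π` and a harmonic `p` of ODD degree `k`, every
paired sum vanishes: `Σ_{d_π(T) = d} p_T = 0` for all `d`. -/
theorem pairedSum_eq_zero_of_odd {π : Fin n → Fin n} (hinv : ∀ x, π (π x) = x) (hfix : ∀ x, π x ≠ x)
    {k : ℕ} (hk : Odd k) {p : Finset (Fin n) → ℝ} (hp : IsHarmonic k p) (d : ℕ) :
    ∑ T ∈ univ.filter (fun T : Finset (Fin n) => (T.filter (fun x => π x ∈ T)).card = d), p T = 0 := by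
  classical
  -- classes above `k - 1` are empty on the support
  have htop : ∀ d', k ≤ d' →
      ∑ T ∈ univ.filter (fun T : Finset (Fin n) => (T.filter (fun x => π x ∈ T)).card = d'), p T = 0 := by
    intro d' hd'
    refine sum_eq_zero fun T hT => ?_
    simp only [mem_filter, mem_univ, true_and] at hT
    by_cases hTk : T.card = k
    · exfalso
      have := card_paired_lt_card_of_odd hinv hfix (T := T) (hTk ▸ hk)
      omega
    · exact hp.1 T hTk
  -- descend from `d' = k - 1 - 2j` using the recurrence (coefficient `k - d' ≠ 0` as `k` is odd... for all `d' < k`)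
  -- we prove: for all `m`, the class `k - 1 - m`... simpler: strong downward induction on `k - d`
  suffices h : ∀ m d', d' + m = k + 1 →
      ∑ T ∈ univ.filter (fun T : Finset (Fin n) => (T.filter (fun x => π x ∈ T)).card = d'), p T = 0 by
    by_cases hd : d ≤ k + 1
    · exact h (k + 1 - d) d (by omega)
    · exact htop d (by omega)
  intro m
  induction m using Nat.strong_induction_on with
  | _ m ih =>
    intro d' hd'
    by_cases hm : m ≤ 1
    · exact htop d' (by omega)
    · -- use the recurrence at `d'`: `(d'+2) Q_{d'+2} + (k - d') Q_{d'} = 0`, with `Q_{d'+2} = 0` by induction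
      have hrec := pairing_recurrence hinv hfix hp d'
      rw [ih (m - 2) (by omega) (d' + 2) (by omega), mul_zero, zero_add] at hrec
      have hne : (k : ℝ) - d' ≠ 0 := by
        have : d' < k := by omega
        have : (d' : ℝ) < k := by exact_mod_cast this
        linarith
      exact (mul_eq_zero.1 hrec).resolve_left hne

/-- **Closed form in even degree.** For a fixed-point-free involution `π`, a harmonic `p` of degree `2κ` and `s ≤ κ`:
`Σ_{d_π(T) = 2s} p_T = (−1)^{κ−s} C(κ,s) · Σ_{d_π(T) = 2κ} p_T` (the last sum runs over the sets made of `κ` pairs). -/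
theorem pairedSum_eq_of_even {π : Fin n → Fin n} (hinv : ∀ x, π (π x) = x) (hfix : ∀ x, π x ≠ x)
    {κ : ℕ} {p : Finset (Fin n) → ℝ} (hp : IsHarmonic (2 * κ) p) {s : ℕ} (hs : s ≤ κ) :
    ∑ T ∈ univ.filter (fun T : Finset (Fin n) => (T.filter (fun x => π x ∈ T)).card = 2 * s), p T =
      (-1 : ℝ) ^ (κ - s) * (κ.choose s : ℝ) *
        ∑ T ∈ univ.filter (fun T : Finset (Fin n) => (T.filter (fun x => π x ∈ T)).card = 2 * κ), p T := by
  obtain ⟨j, hj⟩ : ∃ j, s + j = κ := ⟨κ - s, by omega⟩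
  induction j generalizing s with
  | zero =>
    obtain rfl : s = κ := by omega
    simp
  | succ j ih =>
    have hrec := pairing_recurrence hinv hfix hp (2 * s)
    rw [show 2 * s + 2 = 2 * (s + 1) by ring, ih (by omega) (by omega)] at hrec
    have hk1 : κ - (s + 1) = j := by omega
    have hk2 : κ - s = j + 1 := by omega
    rw [hk1] at hrec
    rw [hk2, pow_succ]
    have hcoef : ((2 * κ : ℕ) : ℝ) - ((2 * s : ℕ) : ℝ) = 2 * ((j : ℝ) + 1) := by
      push_cast; rw [← hj]; push_cast; ring
    rw [hcoef] at hrec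
    have hj1 : (2 : ℝ) * ((j : ℝ) + 1) ≠ 0 := by positivity
    -- binomial identity `(s+1)·C(κ, s+1) = (κ - s)·C(κ, s) = (j+1)·C(κ,s)`
    have hbin : ((s : ℝ) + 1) * (κ.choose (s + 1) : ℝ) = ((j : ℝ) + 1) * (κ.choose s : ℝ) := by
      have h2 := Nat.choose_succ_right_eq κ s
      rw [show κ - s = j + 1 by omega] at h2
      have h2' : (κ.choose (s + 1) : ℝ) * ((s : ℝ) + 1) = (κ.choose s : ℝ) * ((j : ℝ) + 1) := by exact_mod_cast h2
      linarith [h2']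
    have h3 : (2 : ℝ) * ((j : ℝ) + 1) *
        ∑ T ∈ univ.filter (fun T : Finset (Fin n) => (T.filter (fun x => π x ∈ T)).card = 2 * s), p T =
        (2 : ℝ) * ((j : ℝ) + 1) * ((-1 : ℝ) ^ j * (-1) * (κ.choose s : ℝ) *
          ∑ T ∈ univ.filter (fun T : Finset (Fin n) => (T.filter (fun x => π x ∈ T)).card = 2 * κ), p T) := by
      have : ((2 * s : ℕ) : ℝ) + 2 = 2 * ((s : ℝ) + 1) := by push_cast; ring
      rw [this] at hrec
      have : (2 : ℝ) * ((s : ℝ) + 1) * ((-1 : ℝ) ^ j * (κ.choose (s + 1) : ℝ) *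
          ∑ T ∈ univ.filter (fun T : Finset (Fin n) => (T.filter (fun x => π x ∈ T)).card = 2 * κ), p T) =
          2 * (-1 : ℝ) ^ j * (((s : ℝ) + 1) * (κ.choose (s + 1) : ℝ)) *
          ∑ T ∈ univ.filter (fun T : Finset (Fin n) => (T.filter (fun x => π x ∈ T)).card = 2 * κ), p T := by ring
      rw [this, hbin] at hrec
      linarith
    exact mul_left_cancel₀ hj1 h3

end Summit.PneNP.PneNP.Theorems.ChebyshevTracialDesignMatchingHarmonics
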